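import Literature.Algebra.Lie.RankInvariance
import Literature.NumberTheory.Automorphic.LieAlgebraGLBracket
import Literature.NumberTheory.Automorphic.LieAlgebraGLFiniteIndex
import Literature.NumberTheory.Automorphic.LieAlgebraGLFieldAut
import Literature.NumberTheory.Automorphic.TorusLieDual
import HarnessLib

/-!
# The semisimple rank of the Zariski closure of a subgroup of `GL_n` (algebraic monodromy)

For a field `F`, a finite index type `n` and a subgroup `G ≤ GL n F` — typically the image
`G = ρ(Γ_K)` of an `ℓ`-adic Galois representation, whose Zariski closure is the *algebraic
monodromy group* `G_ℓ` with Lie algebra `𝔤_ℓ` [cite: Hui2013MRL, §1] — the tree already provides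
the Lie algebra of (the Zariski closure of) `G`:
`Literature.NumberTheory.Automorphic.lieAlgebraGL G ⊆ 𝔤𝔩ₙ` (the tangent space at `1` cut out by
the differentials of the vanishing ideal of `G` in the coordinates `x i j, det⁻¹`, Springer 4.1.3,
4.4.5) and its Lie subalgebra structure `lieSubalgebraGL G` (`LieAlgebraGLBracket.lean`).  This
file adds the one missing notion and its invariance properties:

* `semisimpleRankOf F n G : ℕ := rank 𝔤 - dim 𝔷(𝔤)` for `𝔤 = lieSubalgebraGL G`, with
  Mathlib's `LieAlgebra.rank` (dimension of a generic Engel subalgebra = of a Cartan subalgebra)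
  and `LieAlgebra.center`.  When `𝔤` is reductive — e.g. `G` the image of a semisimple
  representation in characteristic `0`, `𝔤 = 𝔷(𝔤) ⊕ [𝔤, 𝔤]` — this is the rank of the semisimple
  part `[𝔤, 𝔤] = Lie((G_ℓ°)^der)`, the **semisimple rank** of `G_ℓ°`, whose independence of `ℓ`
  in a compatible system is [cite: Hui2013MRL, Thm 3.19 and (3.20)].  Truncated subtraction is
  harmless (`𝔷(𝔤)` lies in every Engel subalgebra, so `dim 𝔷 ≤ rank`).

API (the invariances a user transporting the semisimple rank along conjugations, finite-index
subgroups and coefficient automorphisms needs):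

* `conjLieEquiv g = Ad g` on `𝔤𝔩ₙ`; `lieSubalgebraGL_map_conj : Lie(g G g⁻¹) = Ad(g) Lie(G)`
  (from the tree's `mem_lieAlgebraGL_map_conj_iff`), `lieSubalgebraGLConjEquiv`, and
  `semisimpleRankOf_map_conj` (`[Infinite F]`);
* `semisimpleRankOf_zariskiClosure`, `semisimpleRankOf_eq_of_finiteIndex` (from
  `lieSubalgebraGL_zariskiClosure`, `lieSubalgebraGL_eq_of_finiteIndex`);
* `semisimpleRankOf_map_ringEquiv` (`[Infinite F]`): invariance under a field automorphism
  `σ : F ≃+* F` applied entrywise (from `map_mem_lieAlgebraGL_map_iff` and the `σ`-semilinear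
  invariance of rank and centre, `Literature.Algebra.Lie.rank_eq_of_semilinear`).

Tree search (what is reused, not restated): `lieAlgebraGL`, `lieSubalgebraGL`,
`mem_lieSubalgebraGL_iff`, `conj_mem_lieAlgebraGL_map_conj` / `mem_lieAlgebraGL_map_conj_iff`
(`LieAlgebraGLTorusHull.lean`, `TorusLieDual.lean`), `mulVec_mem_of_forall_mulVec_mem`
(`LieAlgebraGLStabilizer.lean`: `G`-stable subspaces are `Lie(G)`-stable), `zariskiClosure`
(`ZariskiGL.lean`); Mathlib: `LieAlgebra.rank`, `LieAlgebra.center`, `AlgEquiv.toLieEquiv`,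
`LieEquiv.ofSubalgebras`, `MulAut.conj`, `Matrix.GeneralLinearGroup.map`.  A `Set`-valued input
`S ⊆ GL n F` is not needed: images of representations are subgroups (`MonoidHom.range`), and for a
general `S` one uses `Subgroup.closure S`.
-/

noncomputable section

open Literature.NumberTheory.Automorphic

namespace Literature.NumberTheory.GaloisRepresentations

-- Tree idiom (`Mathlib/Algebra/Lie/Matrix.lean`, `LieAlgebraGLBracket.lean`): the commutator
-- bracket on `Matrix n n F`.
attribute [local instance 100] LieRing.ofAssociativeRing

variable (F : Type*) [Field F] (n : Type*) [Fintype n] [DecidableEq n]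

/-- **Semisimple rank** of (the Zariski closure of) a subgroup `G ≤ GL_n(F)`:
`rank 𝔤 - dim 𝔷(𝔤)` for `𝔤 = lieSubalgebraGL G = Lie(Ḡ) ⊆ 𝔤𝔩ₙ` (`LieAlgebra.rank` = dimension of
a generic Engel subalgebra, i.e. of a Cartan subalgebra in characteristic `0`).  For reductive
`𝔤 = 𝔷(𝔤) ⊕ [𝔤, 𝔤]` (e.g. `G` the image of a semisimple `ℓ`-adic representation, `Ḡ = G_ℓ` the
algebraic monodromy group) this is the rank of the semisimple part, the semisimple rank of `G_ℓ°`
[cite: Hui2013MRL, (3.20)].  Truncated subtraction: `𝔷(𝔤)` lies in every Engel subalgebra. -/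
def semisimpleRankOf (G : Subgroup (GL n F)) : ℕ :=
  LieAlgebra.rank F (lieSubalgebraGL G) - Module.finrank F (LieAlgebra.center F (lieSubalgebraGL G))

variable {F n}

/-- `semisimpleRankOf` only depends on the Lie algebra `Lie(G)`. [folklore] -/
theorem semisimpleRankOf_eq_of_lieSubalgebraGL_eq {G₁ G₂ : Subgroup (GL n F)}
    (h : lieSubalgebraGL G₁ = lieSubalgebraGL G₂) : semisimpleRankOf F n G₁ = semisimpleRankOf F n G₂ := by
  have key : ∀ L₁ L₂ : LieSubalgebra F (Matrix n n F), L₁ = L₂ →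
      LieAlgebra.rank F L₁ - Module.finrank F (LieAlgebra.center F L₁) =
        LieAlgebra.rank F L₂ - Module.finrank F (LieAlgebra.center F L₂) := by
    rintro L₁ _ rfl; rfl
  exact key _ _ h

/-- Isomorphic Lie algebras give the same semisimple rank (over an infinite field, where
`LieAlgebra.rank` is the minimal dimension of an Engel subalgebra). [folklore] -/
theorem semisimpleRankOf_eq_of_lieEquiv [Infinite F] {G₁ G₂ : Subgroup (GL n F)}
    (e : lieSubalgebraGL G₁ ≃ₗ⁅F⁆ lieSubalgebraGL G₂) :
    semisimpleRankOf F n G₁ = semisimpleRankOf F n G₂ := by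
  rw [semisimpleRankOf, semisimpleRankOf, Literature.Algebra.Lie.rank_eq_of_lieEquiv e,
    Literature.Algebra.Lie.finrank_center_eq_of_lieEquiv e]

/-! ### Zariski closure and finite-index subgroups -/

/-- `G` and its Zariski closure have the same semisimple rank (`Lie(Ḡ) = Lie(G)`). [folklore] -/
theorem semisimpleRankOf_zariskiClosure (G : Subgroup (GL n F)) :
    semisimpleRankOf F n (zariskiClosure G) = semisimpleRankOf F n G :=
  semisimpleRankOf_eq_of_lieSubalgebraGL_eq (lieSubalgebraGL_zariskiClosure G)

/-- **Finite-index subgroups have the same semisimple rank** (`Lie(H) = Lie(Γ)` for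
`[Γ : H] < ∞`; e.g. restriction of a Galois representation to an open subgroup). [folklore] -/
theorem semisimpleRankOf_eq_of_finiteIndex {H Γ : Subgroup (GL n F)} (hle : H ≤ Γ)
    [(H.subgroupOf Γ).FiniteIndex] : semisimpleRankOf F n H = semisimpleRankOf F n Γ :=
  semisimpleRankOf_eq_of_lieSubalgebraGL_eq (lieSubalgebraGL_eq_of_finiteIndex hle)

/-! ### Conjugation (`Ad`) -/

/-- **Conjugation by `g ∈ GL_n(F)`** as an `F`-algebra automorphism `X ↦ g X g⁻¹` of `M_n(F)`.
[folklore] -/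
def conjAlgEquiv (g : GL n F) : Matrix n n F ≃ₐ[F] Matrix n n F where
  toFun X := (g : Matrix n n F) * X * ((g⁻¹ : GL n F) : Matrix n n F)
  invFun X := ((g⁻¹ : GL n F) : Matrix n n F) * X * (g : Matrix n n F)
  left_inv X := by
    simp only [← Matrix.mul_assoc, Units.inv_mul, Matrix.one_mul]
    rw [Matrix.mul_assoc, Units.inv_mul, Matrix.mul_one]
  right_inv X := by
    simp only [← Matrix.mul_assoc, Units.mul_inv, Matrix.one_mul]
    rw [Matrix.mul_assoc, Units.mul_inv, Matrix.mul_one]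
  map_mul' X Y := by
    simp only [Matrix.mul_assoc]
    rw [← Matrix.mul_assoc ((g⁻¹ : GL n F) : Matrix n n F) (g : Matrix n n F), Units.inv_mul,
      Matrix.one_mul]
  map_add' X Y := by simp [Matrix.mul_add, Matrix.add_mul]
  commutes' r := by simp [Algebra.algebraMap_eq_smul_one]

/-- Unfolding of `conjAlgEquiv`. [folklore] -/
@[simp] theorem conjAlgEquiv_apply (g : GL n F) (X : Matrix n n F) :
    conjAlgEquiv g X = (g : Matrix n n F) * X * ((g⁻¹ : GL n F) : Matrix n n F) :=
  rfl

/-- `Ad g`: conjugation by `g` as a Lie algebra automorphism of `𝔤𝔩ₙ(F)` (Springer 4.4.5 (ii)).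
[folklore] -/
def conjLieEquiv (g : GL n F) : Matrix n n F ≃ₗ⁅F⁆ Matrix n n F :=
  (conjAlgEquiv g).toLieEquiv

/-- Unfolding of `conjLieEquiv`. [folklore] -/
@[simp] theorem conjLieEquiv_apply (g : GL n F) (X : Matrix n n F) :
    conjLieEquiv g X = (g : Matrix n n F) * X * ((g⁻¹ : GL n F) : Matrix n n F) :=
  rfl

/-- **`Lie(g G g⁻¹) = Ad(g) Lie(G)`** as Lie subalgebras of `𝔤𝔩ₙ` (the tree's
`mem_lieAlgebraGL_map_conj_iff`, Springer 4.4.5 (ii)). [cite: SpringerLAG1998, 4.4.5 (ii)] -/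
theorem lieSubalgebraGL_map_conj (G : Subgroup (GL n F)) (g : GL n F) :
    lieSubalgebraGL (G.map (MulAut.conj g : GL n F →* GL n F)) =
      (lieSubalgebraGL G).map (conjLieEquiv g).toLieHom := by
  refine SetLike.ext fun X => ?_
  rw [LieSubalgebra.mem_map]
  constructor
  · intro hX
    refine ⟨((g⁻¹ : GL n F) : Matrix n n F) * X * (g : Matrix n n F), ?_, ?_⟩
    · rw [mem_lieSubalgebraGL_iff, ← mem_lieAlgebraGL_map_conj_iff g]
      convert (mem_lieSubalgebraGL_iff.mp hX) using 1
      simp only [← Matrix.mul_assoc, Units.mul_inv, Matrix.one_mul]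
      rw [Matrix.mul_assoc, Units.mul_inv, Matrix.mul_one]
    · change (g : Matrix n n F) * _ * _ = X
      simp only [← Matrix.mul_assoc, Units.mul_inv, Matrix.one_mul]
      rw [Matrix.mul_assoc, Units.mul_inv, Matrix.mul_one]
  · rintro ⟨Y, hY, rfl⟩
    exact (mem_lieAlgebraGL_map_conj_iff g).2 hY

/-- The Lie algebras of `G` and of `g G g⁻¹` are isomorphic via `Ad g`. [folklore] -/
def lieSubalgebraGLConjEquiv (G : Subgroup (GL n F)) (g : GL n F) :
    lieSubalgebraGL G ≃ₗ⁅F⁆ lieSubalgebraGL (G.map (MulAut.conj g : GL n F →* GL n F)) :=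
  (conjLieEquiv g).ofSubalgebras _ _ (lieSubalgebraGL_map_conj G g).symm

/-- **The semisimple rank is a conjugation invariant**: `semisimpleRankOf (g G g⁻¹) =
semisimpleRankOf G` (`[Infinite F]`, e.g. any field of characteristic `0`). [folklore] -/
theorem semisimpleRankOf_map_conj [Infinite F] (G : Subgroup (GL n F)) (g : GL n F) :
    semisimpleRankOf F n (G.map (MulAut.conj g : GL n F →* GL n F)) = semisimpleRankOf F n G :=
  (semisimpleRankOf_eq_of_lieEquiv (lieSubalgebraGLConjEquiv G g)).symm

/-! ### Field automorphisms applied entrywise -/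

/-- **The semisimple rank is invariant under a field automorphism applied entrywise** (e.g.
`Gal(ℚ̄_ℓ/ℚ_ℓ)` acting on the coefficients of an `ℓ`-adic representation): `A ↦ σ A` is a
`σ`-semilinear isomorphism `Lie(G) ≃ Lie(σ G)` of Lie rings (`map_mem_lieAlgebraGL_map_iff`),
which preserves rank and centre dimension (`Literature.Algebra.Lie.rank_eq_of_semilinear`).
[folklore] -/
theorem semisimpleRankOf_map_ringEquiv [Infinite F] (σ : F ≃+* F) (G : Subgroup (GL n F)) :
    semisimpleRankOf F n (G.map (Matrix.GeneralLinearGroup.map (σ : F →+* F))) =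
      semisimpleRankOf F n G := by
  set G' := G.map (Matrix.GeneralLinearGroup.map (σ : F →+* F)) with hG'
  -- the `σ`-semilinear additive isomorphism `Lie(G) ≃+ Lie(σ G)`, `A ↦ σ A`
  let j : lieSubalgebraGL G ≃+ lieSubalgebraGL G' :=
    { toFun := fun A => ⟨(A : Matrix n n F).map σ, (map_mem_lieAlgebraGL_map_iff σ).2 A.2⟩
      invFun := fun B => ⟨(B : Matrix n n F).map σ.symm, by
        have h := map_mem_lieAlgebraGL_map σ.symm B.2
        rwa [subgroup_map_map_symm] at h⟩
      left_inv := fun A => Subtype.ext (matrix_map_map_symm σ (A : Matrix n n F))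
      right_inv := fun B => Subtype.ext (by
        change ((B : Matrix n n F).map σ.symm).map σ = B
        ext i j; simp)
      map_add' := fun A B => Subtype.ext (map_add σ.mapMatrix (A : Matrix n n F) (B : Matrix n n F)) }
  have hj : ∀ A : lieSubalgebraGL G, ((j A : lieSubalgebraGL G') : Matrix n n F) =
      σ.mapMatrix (A : Matrix n n F) := fun _ => rfl
  have hlie : ∀ x y : lieSubalgebraGL G, j ⁅x, y⁆ = ⁅j x, j y⁆ := by
    intro x y
    apply Subtype.ext
    rw [LieSubalgebra.coe_bracket, hj, hj, hj, LieSubalgebra.coe_bracket, Ring.lie_def,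
      Ring.lie_def, map_sub, map_mul, map_mul]
  have hsmul : ∀ (c : F) (x : lieSubalgebraGL G), j (c • x) = σ c • j x := by
    intro c x
    apply Subtype.ext
    rw [hj, Submodule.coe_smul_of_tower, Submodule.coe_smul_of_tower, hj]
    ext i j'
    simp
  rw [semisimpleRankOf, semisimpleRankOf, Literature.Algebra.Lie.rank_eq_of_semilinear σ j hlie hsmul,
    Literature.Algebra.Lie.finrank_center_eq_of_semilinear σ j hlie hsmul]

end Literature.NumberTheory.GaloisRepresentations

end
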